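import Mathlib
import HarnessLib
import Literature.Analysis.FluidPDE.ClassicalSolution
import Literature.Analysis.FluidPDE.LerayHopf
import Literature.Analysis.FluidPDE.NSWave0
import Literature.Analysis.FluidPDE.SuitableWeak
import Literature.Analysis.FluidPDE.AxisymmetricEuler
import Literature.Analysis.FluidPDE.NSCriticalClosureBesovKatoClass
import Literature.Barriers.NavierStokesRegularity.AxisymmetricTypeIExclusionHolds
import Literature.Barriers.NavierStokesRegularity.SingularSetDimensionBoundHolds
import Summits.NavierStokesRegularity.NavierStokesRegularity.Theses.StretchingWellBinding
import Summits.NavierStokesRegularity.NavierStokesRegularity.Theorems.LerayQuarterDissipationRecordTimeTypeI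
import Summits.NavierStokesRegularity.NavierStokesRegularity.Theorems.StretchingWellBindingEnstrophyQuarterLawAxisymCalibration

/-!
# Hardness calibration of shelf 1574 — `EnstrophyQuarterLaw ⇒ axisymmetric (with swirl) no-blow-up`

A CALIBRATION of the crux `StretchingWellBinding.EnstrophyQuarterLaw` (stmt-NavierStokesRegularity-1574,
the residual of the whole eI-shelf), not a line toward it: the quarter law ALONE already decides the
axisymmetric-with-swirl case of Clay (A) — a named open problem — by two results that are THEOREMS in
the tree:

* `…Theorems.lerayQuarterDissipation_recordTimeTypeI_proof` (closed item 19762 `RecordTimeTypeI`):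
  the slice law `Z(t) ≤ K/√(T-t)` forces the sup-norm Type-I rate `IsTypeIBlowup u T`;
* `Literature.Barriers.NavierStokesRegularity.AxisymmetricTypeIExclusion_holds` (Seregin–Šverák 2009,
  Thm. 3.1 = KNSS 2009 §6, proved in tree from its named facts): an axisymmetric distributional solution
  in the unit backward cylinder with `u ∈ L³`, `p ∈ L^{3/2}` and the a.e. Type-I bound is essentially
  bounded near the vertex;
* plus, for a vertex OFF the axis, CKN partial regularity `Literature.Analysis.FluidPDE.ckn_partial_regularity`
  (in-tree, `SingularSetDimensionBound_holds`): rotating an off-axis singular vertex about the axis gives a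
  circle of singular vertices at time `T`, of positive one-dimensional parabolic measure.

STATUS 2026-08-28 (ns-hhe-c1 g3): LANDED — both stubs and the by-name forms are tree theorems
(`Theorems/StretchingWellBindingEnstrophyQuarterLawAxisymCalibration.lean`, p617443); this file is now 0-sorry.

So `EnstrophyQuarterLaw → AxisymmetricNoBlowup` below WAS an M-size PROVER TARGET (bookkeeping:
translation along the axis, parabolic rescaling to `ν = 1` and the unit cylinder, classical ⇒
distributional with normalised pressure, Leray–Hopf ⇒ `u ∈ L^{10/3} ⊂ L³(Q)`, `p ∈ L^{5/3} ⊂ L^{3/2}(Q)`,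
the eventual Type-I bound made a.e. on the cylinder), stated here as the composition
`axisymmetricNoBlowup_of_enstrophyQuarterLaw : stub_onAxisVertexRegular → stub_offAxisVertexRegular →
EnstrophyQuarterLaw → AxisymmetricNoBlowup` with the composition kernel-checked and the two case
lemmas left as named stubs. CONSEQUENCE FOR THE LADDER: every route resting on shelf 1574
(LerayQuarterDissipation, CalmSliceGate, QLP, StretchingWellBinding, QuarterBudgetTrace, QuarterJolt, …)
has a residual at least as strong as axisymmetric-with-swirl global regularity; conversely an
axisymmetric blow-up (Hou-type scenario made rigorous) refutes the shelf outright. No summit is proved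
by this file.
-/

noncomputable section

namespace Summit.NavierStokesRegularity.NavierStokesRegularity.Cruxes.EnstrophyQuarterLaw.AxisymCalibration

open Filter Set MeasureTheory Topology Function

/-- Clay (A) restricted to axisymmetric evolutions: a classical Leray–Hopf solution from a rapidly
decaying datum whose every slice `u t`, `t ∈ [0,T)`, is axisymmetric about the `x₃`-axis extends
smoothly past `T` (the axisymmetric-WITH-swirl regularity problem, open; the slice-wise symmetry
hypothesis sidesteps symmetry propagation, which needs classical uniqueness). -/
def AxisymmetricNoBlowup : Prop :=
  ∀ (ν T : ℝ), 0 < ν → 0 < T →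
    ∀ (u : ℝ → EuclideanSpace ℝ (Fin 3) → EuclideanSpace ℝ (Fin 3)) (p : ℝ → EuclideanSpace ℝ (Fin 3) → ℝ),
      Literature.Analysis.FluidPDE.IsClassicalNSSolutionOn (Set.Ico 0 T) ν 0 u p →
      Literature.Analysis.FluidPDE.IsLerayHopfOn T ν 0 (u 0) u →
      Literature.Analysis.FluidPDE.HasRapidSpatialDecay (u 0) →
      (∀ t ∈ Set.Ico 0 T, Literature.Analysis.FluidPDE.IsAxisymmetric (u t)) →
      Literature.Analysis.FluidPDE.HasSmoothExtensionPast ν 0 u T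

/-- stub (on-axis vertex, the KNSS/Seregin–Šverák step): under the sup-norm Type-I rate an axisymmetric
classical Leray–Hopf solution has NO singular vertex on the symmetry axis — translate the vertex to the
origin along the axis, rescale parabolically to `ν = 1` and the unit backward cylinder, pass classical ⇒
distributional with normalised pressure (`u ∈ L³(Q)`, `p ∈ L^{3/2}(Q)` from the Leray–Hopf class), make
the eventual Type-I bound a.e. on the cylinder, and apply
`Literature.Barriers.NavierStokesRegularity.AxisymmetricTypeIExclusion_holds`. Size M (bookkeeping only). -/
theorem stub_onAxisVertexRegular :
    ∀ (ν T : ℝ), 0 < ν → 0 < T →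
    ∀ (u : ℝ → EuclideanSpace ℝ (Fin 3) → EuclideanSpace ℝ (Fin 3)) (p : ℝ → EuclideanSpace ℝ (Fin 3) → ℝ),
      Literature.Analysis.FluidPDE.IsClassicalNSSolutionOn (Set.Ico 0 T) ν 0 u p →
      Literature.Analysis.FluidPDE.IsLerayHopfOn T ν 0 (u 0) u →
      Literature.Analysis.FluidPDE.HasRapidSpatialDecay (u 0) →
      (∀ t ∈ Set.Ico 0 T, Literature.Analysis.FluidPDE.IsAxisymmetric (u t)) →
      Literature.Analysis.FluidPDE.IsTypeIBlowup u T →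
      ∀ x₀ : EuclideanSpace ℝ (Fin 3), x₀ 0 = 0 → x₀ 1 = 0 →
        ∃ r : ℝ, 0 < r ∧ r ^ 2 < T ∧
          eLpNorm (uncurry u) ⊤ (volume.restrict
            (Literature.Analysis.FluidPDE.parabolicCylinder r ((T : ℝ), x₀))) < ⊤ :=
  -- CLOSED by name (ns-hhe-c1 g3, p617443): the landed Theorems lemma with this signature verbatim
  Summit.NavierStokesRegularity.NavierStokesRegularity.Theorems.EnstrophyQuarterLaw.AxisymCalibration.onAxisVertexRegular

/-- stub (off-axis vertex, the CKN step — unconditional, no rate hypothesis): an axisymmetric classical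
Leray–Hopf solution has NO singular vertex off the symmetry axis at its first singular time — by
rotation covariance every point of the circle through an off-axis singular vertex is a singular vertex,
a circle `× {T}` has positive one-dimensional parabolic Hausdorff measure, contradicting
`Literature.Analysis.FluidPDE.ckn_partial_regularity` for the suitable weak solution the classical
solution defines near `(T, x₀)` (`isSuitableWeakSolutionInBall_apex_of_classical`). Size M. -/
theorem stub_offAxisVertexRegular :
    ∀ (ν T : ℝ), 0 < ν → 0 < T →
    ∀ (u : ℝ → EuclideanSpace ℝ (Fin 3) → EuclideanSpace ℝ (Fin 3)) (p : ℝ → EuclideanSpace ℝ (Fin 3) → ℝ),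
      Literature.Analysis.FluidPDE.IsClassicalNSSolutionOn (Set.Ico 0 T) ν 0 u p →
      Literature.Analysis.FluidPDE.IsLerayHopfOn T ν 0 (u 0) u →
      Literature.Analysis.FluidPDE.HasRapidSpatialDecay (u 0) →
      (∀ t ∈ Set.Ico 0 T, Literature.Analysis.FluidPDE.IsAxisymmetric (u t)) →
      ∀ x₀ : EuclideanSpace ℝ (Fin 3), ¬ (x₀ 0 = 0 ∧ x₀ 1 = 0) →
        ∃ r : ℝ, 0 < r ∧ r ^ 2 < T ∧
          eLpNorm (uncurry u) ⊤ (volume.restrict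
            (Literature.Analysis.FluidPDE.parabolicCylinder r ((T : ℝ), x₀))) < ⊤ :=
  -- CLOSED by name (ns-hhe-c1 g3, p617443): the landed RATE-FREE Theorems lemma with this signature verbatim
  -- (rotation packing of the dissipation + Seregin's backward ε-regularity at the apex; no continuation past `T`)
  Summit.NavierStokesRegularity.NavierStokesRegularity.Theorems.EnstrophyQuarterLaw.AxisymCalibration.offAxisVertexRegular

/-- **Calibration (composition kernel-checked): the enstrophy quarter law implies axisymmetric-with-swirl
no-blow-up**, given the two case lemmas. Logic: if an axisymmetric frame solution failed to extend, the
quarter law gives the slice bound `Z ≤ K/√(T-t)`, `lerayQuarterDissipation_recordTimeTypeI_proof` turns it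
into `IsTypeIBlowup u T`, `exists_singularPoint_of_classical_of_not_hasSmoothExtensionPast` produces a
singular vertex `x₀`, and the on-axis / off-axis lemmas bound `u` near `(T, x₀)` — contradiction. -/
theorem axisymmetricNoBlowup_of_enstrophyQuarterLaw
    (h₁ : ∀ (ν T : ℝ), 0 < ν → 0 < T →
      ∀ (u : ℝ → EuclideanSpace ℝ (Fin 3) → EuclideanSpace ℝ (Fin 3)) (p : ℝ → EuclideanSpace ℝ (Fin 3) → ℝ),
        Literature.Analysis.FluidPDE.IsClassicalNSSolutionOn (Set.Ico 0 T) ν 0 u p →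
        Literature.Analysis.FluidPDE.IsLerayHopfOn T ν 0 (u 0) u →
        Literature.Analysis.FluidPDE.HasRapidSpatialDecay (u 0) →
        (∀ t ∈ Set.Ico 0 T, Literature.Analysis.FluidPDE.IsAxisymmetric (u t)) →
        Literature.Analysis.FluidPDE.IsTypeIBlowup u T →
        ∀ x₀ : EuclideanSpace ℝ (Fin 3), x₀ 0 = 0 → x₀ 1 = 0 →
          ∃ r : ℝ, 0 < r ∧ r ^ 2 < T ∧
            eLpNorm (uncurry u) ⊤ (volume.restrict
              (Literature.Analysis.FluidPDE.parabolicCylinder r ((T : ℝ), x₀))) < ⊤)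
    (h₂ : ∀ (ν T : ℝ), 0 < ν → 0 < T →
      ∀ (u : ℝ → EuclideanSpace ℝ (Fin 3) → EuclideanSpace ℝ (Fin 3)) (p : ℝ → EuclideanSpace ℝ (Fin 3) → ℝ),
        Literature.Analysis.FluidPDE.IsClassicalNSSolutionOn (Set.Ico 0 T) ν 0 u p →
        Literature.Analysis.FluidPDE.IsLerayHopfOn T ν 0 (u 0) u →
        Literature.Analysis.FluidPDE.HasRapidSpatialDecay (u 0) →
        (∀ t ∈ Set.Ico 0 T, Literature.Analysis.FluidPDE.IsAxisymmetric (u t)) →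
        ∀ x₀ : EuclideanSpace ℝ (Fin 3), ¬ (x₀ 0 = 0 ∧ x₀ 1 = 0) →
          ∃ r : ℝ, 0 < r ∧ r ^ 2 < T ∧
            eLpNorm (uncurry u) ⊤ (volume.restrict
              (Literature.Analysis.FluidPDE.parabolicCylinder r ((T : ℝ), x₀))) < ⊤) :
    Summit.NavierStokesRegularity.NavierStokesRegularity.Theses.StretchingWellBinding.EnstrophyQuarterLaw →
      AxisymmetricNoBlowup := by
  intro hQ ν T hν hT u p hcl hLH hdec hax
  by_contra hext
  obtain ⟨K, hK⟩ := hQ ν T hν hT u p ⟨hcl, hext⟩ hLH hdec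
  have hTypeI : Literature.Analysis.FluidPDE.IsTypeIBlowup u T :=
    Summit.NavierStokesRegularity.NavierStokesRegularity.Theorems.lerayQuarterDissipation_recordTimeTypeI_proof
      ν T hν hT u p hcl hLH hdec K hK
  obtain ⟨x₀, hx₀⟩ :=
    Literature.Analysis.FluidPDE.exists_singularPoint_of_classical_of_not_hasSmoothExtensionPast
      hν hT hcl hLH hdec hext
  by_cases hon : x₀ 0 = 0 ∧ x₀ 1 = 0
  · obtain ⟨r, hr, hrT, hfin⟩ := h₁ ν T hν hT u p hcl hLH hdec hax hTypeI x₀ hon.1 hon.2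
    exact hfin.ne (hx₀ r hr hrT)
  · obtain ⟨r, hr, hrT, hfin⟩ := h₂ ν T hν hT u p hcl hLH hdec hax x₀ hon
    exact hfin.ne (hx₀ r hr hrT)

/-- The same calibration with the stubs discharged by name — now 0-sorry (both case lemmas landed in
`Theorems/StretchingWellBindingEnstrophyQuarterLawAxisymCalibration.lean`, p617443, which also carries the by-name
forms `EnstrophyQuarterLaw → Summit.NavierStokesRegularity.NavierStokesRegularity.AxisymmetricSwirlRegularity` (ns.S25),
`→ AxisymSwirlRegular` (1964), `→ AxisymmetricSwirlRegularityWall` (11332) and `CertifiedBlowupAxisymBlowup → ¬ EnstrophyQuarterLaw` (0727)). -/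
theorem axisymmetricNoBlowup_of_enstrophyQuarterLaw' :
    Summit.NavierStokesRegularity.NavierStokesRegularity.Theses.StretchingWellBinding.EnstrophyQuarterLaw →
      AxisymmetricNoBlowup :=
  axisymmetricNoBlowup_of_enstrophyQuarterLaw stub_onAxisVertexRegular stub_offAxisVertexRegular

end Summit.NavierStokesRegularity.NavierStokesRegularity.Cruxes.EnstrophyQuarterLaw.AxisymCalibration

end
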